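import Summits.QuantumFields.BalabanUV.Beta.GAN24.DirichletExhaustionCoer
import Summits.QuantumFields.BalabanUV.Beta.GAN24.EffectiveLaplacianLimit

/-!
# `BalabanUV.Beta.GAN24.EffectiveCovarianceLimit` — binder row G-an2-4 ∕ (CONV-C): THE `k = ∞` LIMIT OF THE COVARIANCE CONSTITUENT NAMED
# EXPLICITLY — the PERFECT (2.156)-shaped covariance `C^{(∞)}_Λ = C·(pad(CᵀΔ_∞C))_Λ⁻¹·Cᵀ` on `ℤ^{d+1}` built on Bałaban's perfect effective
# Laplacian `Δ_∞ = EffectiveLaplacianLimit.deltaZLim`, with `C^{(k)}_Λ → C^{(∞)}_Λ` at King's ratio `L⁻²` and the SAME displayed constants as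
# gan24-p2's `DirichletExhaustionCoer.convC_balaban` (row owner lineage gan24-p3, gen 12)

NOT IN PRINT; OUR PROOF (bookkeeping over tree theorems BY NAME).  HONEST FRAMING (cell contract, verbatim): «discharging `BetaPertH` makes
Bałaban's UV stability UNCONDITIONAL — a real constructive-QFT result; it is NOT the continuum limit and NOT the Clay problem.»  HONEST DEPENDENCY
(verbatim): «continuum YM on T⁴ ⇐ BetaPertH ∧ nine spine estimates (0/9 proved); BetaPertH ⇐ (D1) ∧ (D4) ∧ CAP+tail; G-an2-4 gates asym, D1 and
NE2/3/4.»

WHY.  Road P2 of row G-an2-4 (gan24-p2, PARTs 1–19) proved (CONV-C) for the `U = 1` covariance constituent `T = O-an2-2a`: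
`k ↦ C^{(k)}_Λ = covPad (elimZ L) (deltaZ L) (IsFreeZ L) Λ k` ([Balaban1984PropagatorsII] (2.156)–(2.157) p. 250 typed on `ℤ^{d+1}`) satisfies
`ConvC … (L⁻²)` unconditionally (`DirichletExhaustionCoer.convC_balaban`), i.e. `k`-uniform decay + the CAUCHY one-step rate; the limit exists
abstractly (PART 2's `opLim` ∕ `limInv Λ (opLim ·)` for the INNER family) but is not named in terms of Bałaban's objects.  With the perfect Laplacian
`Δ_∞` of `GAN24.EffectiveLaplacianLimit` (`|Δ_k − Δ_∞| ≤ θ166Z(d)·(L⁻²)^k·e^{−κZ·dist}`, every `L`, `k`) the limit becomes EXPLICIT: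
`C^{(∞)}_Λ := C·(pad(CᵀΔ_∞C))_Λ⁻¹·Cᵀ`.  MECHANISM (generic, §1–§2): SPLICE the limit operator into PART 10's socket — the family
`splice Δ Δ_∞ n = (Δ_0, …, Δ_n, Δ_∞, Δ_∞, …)` inhabits `CovInputPad` with the SAME constants (its `n`-th step IS the rate to the limit; the
(2.157)-coercivity of `pad(CᵀΔ_∞C)` is INHERITED from the family by entrywise convergence of finite quadratic forms, §2), so PART 10's
`convC_covPad` read at the members `n, n+1` IS the bound `|C^{(n)}_Λ − C^{(∞)}_Λ| ≤ C₄·θ^n·e^{−δ₄·dist}` with PART 10's displayed `(C₄, δ₄)` —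
no `1/(1 − θ)`.

WHAT IS PROVED (0 sorry, 0 `def … : Prop`; data defs `covLim`, `splice`, `covZLim`; all [our object]∕[folklore]):
* §1 `splice`, `splice_of_le/_of_lt`, `covPad_splice_of_le/_of_lt`, **`covInputPad_splice`**.
* §2 `coer_of_tendsto` (a `k`-uniform quadratic-form lower bound passes to an entrywise limit), `tendsto_padOp_sandwich`, **`coer_padOp_sandwich_lim`**.
* §3 **`covPad_sub_covLim_abs_le`**, `covLim_abs_le`, `tendsto_covPad_covLim` (generic END: rate to ∕ decay of ∕ convergence to `covLim C Δ_∞ Free Λ`).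
* §4 BAŁABAN'S OBJECTS (`d ≥ 1`, `L ≥ 2`): `opClose_deltaZ_deltaZLim`; **`covZLim L Λ`** = the perfect covariance; **`covPad_balaban_sub_covZLim_abs_le`**
  (`|C^{(k)}_Λ − C^{(∞)}_Λ|(b,b′) ≤ C₄(d,L)·(L⁻²)^k·e^{−δ₄(d,L)·|x−y|_∞}`, `(C₄, δ₄)` = `convC_balaban`'s), `covZLim_abs_le`, `tendsto_covPad_balaban`,
  `coer2157Z_lim` ((2.157) for `Δ_∞`), `opLim_balaban_eq` (PART 2's abstract `opLim` of the inner family IS `pad(CᵀΔ_∞C)`), and the `Decays`∕`limMKerOf`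
  currency: `decays_toMKer_covPad_sub_covZLim`, **`limMKerOf_covPad_balaban_eq`** (`limMKerOf (k ↦ toMKer C^{(k)}_Λ) = toMKer C^{(∞)}_Λ`).
HONEST: names a limit and proves convergence to it; restates nothing of PARTs 1–19 (their theorems are imported BY NAME); discharges NOTHING of an2's
wall; NEVER «G-an2-4 closed»; NOT `BetaPertH`, NOT continuum, NOT Clay.

ABSOLUTE RULE (cell, verbatim): «No internally-minted statement may enter as a cited fact. Every hypothesis is either kernel-proved in this package or a
verbatim quotation of a PUBLISHED theorem with page reference. The manuscript(s) under audit are NOT citable for their own disputed steps — they are the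
thing under adjudication; programme-internal (2001/route/tribunal) claims are never citable.»  No hypothesis below is a printed statement; nothing is cited
as a fact.
-/

namespace Summit.QuantumFields.BalabanUV.Beta.GAN24.EffectiveCovarianceLimit

open Finset Real Filter Topology
open scoped BigOperators
open Literature.MathematicalPhysics.QuantumFieldTheory.Balaban1983to89
open Literature.MathematicalPhysics.QuantumFieldTheory.Balaban1983to89.Beta
open B4Sect5Proof (deltaStar deltaStar_pos)
open B4Sect5Exhaustion (K toMat limInv)
open B6Cov2156Torus (gamma2153 gamma2153_pos)
open B12Sec2to5 (l1)
open ExpKernelCalculus (MKer Decays)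
open HessKerDressedLimit (limMKerOf limMKerOf_eq_of_decays_rate)
open Summit.QuantumFields.BalabanUV.Beta.GAN24.DirichletExhaustion (OpClose ConvC OpFamilyRate)
open Summit.QuantumFields.BalabanUV.Beta.GAN24.DirichletExhaustionFamily (opLim tendsto_opLim convConst)
open Summit.QuantumFields.BalabanUV.Beta.GAN24.DirichletExhaustionSandwich (sandwich sandwichConst sandwichConst_nonneg opClose_sandwich)
open Summit.QuantumFields.BalabanUV.Beta.GAN24.DirichletExhaustionCovariance (trK)
open Summit.QuantumFields.BalabanUV.Beta.GAN24.DirichletExhaustionCovariancePad (padOp CovInputPad covPad convC_covPad opClose_padOp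
  opFamilyRate_innerPad)
open Summit.QuantumFields.BalabanUV.Beta.GAN24.DirichletExhaustionDeltaZ (deltaZ c166Z theta166Z kappaZ kappaZ_pos)
open Summit.QuantumFields.BalabanUV.Beta.GAN24.DirichletExhaustionElimZ (IsFreeZ elimZ)
open Summit.QuantumFields.BalabanUV.Beta.GAN24.DirichletExhaustionAssembly (covInputPad_balaban theta166Z_nonneg)
open Summit.QuantumFields.BalabanUV.Beta.GAN24.DirichletExhaustionCoer (coer2157Z)
open Summit.QuantumFields.BalabanUV.Beta.GAN24.DirichletExhaustionDecays (toMKer toMKer_sub decays_toMKer_of_bound)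
open Summit.QuantumFields.BalabanUV.Beta.GAN24.EffectiveLaplacianLimit (deltaZLim deltaZ_sub_deltaZLim_abs_le deltaZLim_abs_le deltaZLim_symm)
open T4Rate166StripDirect (thetaSq_lt_one thetaSq_nonneg)

noncomputable section

/-! ## §1 Splicing a limit operator into PART 10's socket -/

section Splice

variable {d N : ℕ} {Ω : Set (Fin d → ℤ)} {C : K d N → K d N → ℝ} {Δ : ℕ → K d N → K d N → ℝ} {Δinf : K d N → K d N → ℝ}
  {Free : K d N → Prop} [DecidablePred Free] {cC c₀ δ γ θ₀ θ : ℝ}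

/-- [our object] **THE PERFECT (2.156)-SHAPED COVARIANCE** built on a limit operator `Δ_∞`: `covLim C Δ_∞ Free Λ = C·(pad(CᵀΔ_∞C))_Λ⁻¹·Cᵀ`
(PART 10's `covPad` with the constant family `Δ_∞`). -/
def covLim (C : K d N → K d N → ℝ) (Δinf : K d N → K d N → ℝ) (Free : K d N → Prop) [DecidablePred Free]
    (Λ : Set (Fin d → ℤ)) : K d N → K d N → ℝ :=
  sandwich (trK C) (limInv Λ (padOp Free (sandwich C Δinf)))

/-- [our object] The SPLICED family `(Δ_0, …, Δ_n, Δ_∞, Δ_∞, …)`. -/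
def splice (Δ : ℕ → K d N → K d N → ℝ) (Δinf : K d N → K d N → ℝ) (n : ℕ) : ℕ → K d N → K d N → ℝ :=
  fun k => if k ≤ n then Δ k else Δinf

/-- [folklore] Members up to `n` are the original ones. -/
theorem splice_of_le {n k : ℕ} (hk : k ≤ n) : splice Δ Δinf n k = Δ k := if_pos hk

/-- [folklore] Members beyond `n` are the limit operator. -/
theorem splice_of_lt {n k : ℕ} (hk : n < k) : splice Δ Δinf n k = Δinf := if_neg (not_le.mpr hk)

/-- [folklore] The spliced covariance family agrees with the original one up to `n`. -/
theorem covPad_splice_of_le {n k : ℕ} (hk : k ≤ n) (Λ : Set (Fin d → ℤ)) :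
    covPad C (splice Δ Δinf n) Free Λ k = covPad C Δ Free Λ k := by
  unfold covPad; rw [splice_of_le hk]

/-- [folklore] … and is the perfect covariance beyond `n`. -/
theorem covPad_splice_of_lt {n k : ℕ} (hk : n < k) (Λ : Set (Fin d → ℤ)) :
    covPad C (splice Δ Δinf n) Free Λ k = covLim C Δinf Free Λ := by
  unfold covPad covLim; rw [splice_of_lt hk]

/-- [our object] **THE SPLICED FAMILY INHABITS PART 10's SOCKET WITH THE SAME CONSTANTS**, provided the limit operator has the family's decay and
symmetry, the family approaches it at the family's own step rate (`|Δ_∞ − Δ_k| ≤ θ₀θ^k e^{−δ·dist}`), and `pad(CᵀΔ_∞C)` is (2.157)-coercive on `Ω`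
with the family's `γ`. -/
theorem covInputPad_splice (h : CovInputPad Ω C Δ Free cC c₀ δ γ θ₀ θ) (hθ₀ : 0 ≤ θ₀) (hθ : 0 ≤ θ)
    (hΔi : ∀ r s : K d N, |Δinf r s| ≤ c₀ * Real.exp (-(δ * dist r.1 s.1))) (hsymm : ∀ r s : K d N, Δinf r s = Δinf s r)
    (hrate : ∀ k, OpClose (Set.univ : Set (Fin d → ℤ)) (Δ k) Δinf (θ₀ * θ ^ k) δ)
    (hcoer : ∀ (Λ : Finset (Fin d → ℤ)), (↑Λ : Set (Fin d → ℤ)) ⊆ Ω →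
      ∀ v : B4.Idx Λ N → ℝ, γ * ∑ p, v p ^ 2 ≤ ∑ p, v p * (toMat Λ (padOp Free (sandwich C Δinf))).mulVec v p)
    (n : ℕ) : CovInputPad Ω C (splice Δ Δinf n) Free cC c₀ δ γ θ₀ θ where
  hC := h.hC
  hΔ k r s := by
    by_cases hk : k ≤ n
    · rw [splice_of_le hk]; exact h.hΔ k r s
    · rw [splice_of_lt (not_le.mp hk)]; exact hΔi r s
  hΔsymm k r s := by
    by_cases hk : k ≤ n
    · rw [splice_of_le hk]; exact h.hΔsymm k r s
    · rw [splice_of_lt (not_le.mp hk)]; exact hsymm r s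
  hstep k := by
    intro p q hp hq
    by_cases hk1 : k + 1 ≤ n
    · rw [splice_of_le hk1, splice_of_le (Nat.le_of_succ_le hk1)]
      exact h.hstep k p q hp hq
    · by_cases hk : k ≤ n
      · rw [splice_of_le hk, splice_of_lt (not_le.mp hk1)]
        exact hrate k p q hp hq
      · rw [splice_of_lt (not_le.mp hk), splice_of_lt (lt_of_lt_of_le (not_le.mp hk) (Nat.le_succ k)), sub_self, abs_zero]
        positivity
  hcoer k Λ hΛ v := by
    by_cases hk : k ≤ n
    · rw [splice_of_le hk]; exact h.hcoer k Λ hΛ v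
    · rw [splice_of_lt (not_le.mp hk)]; exact hcoer Λ hΛ v

end Splice

/-! ## §2 The (2.157)-coercivity passes to the entrywise limit -/

section Coer

variable {d N : ℕ}

/-- [folklore] A `k`-UNIFORM quadratic-form lower bound `γ‖v‖² ≤ ⟨v, (A_k)_Λ v⟩` on a finite `Λ` passes to any ENTRYWISE limit `A_∞` of the
operators (finite sums of convergent sequences). -/
theorem coer_of_tendsto {Λ : Finset (Fin d → ℤ)} {A : ℕ → K d N → K d N → ℝ} {Ainf : K d N → K d N → ℝ} {γ : ℝ}
    (hco : ∀ k (v : B4.Idx Λ N → ℝ), γ * ∑ p, v p ^ 2 ≤ ∑ p, v p * (toMat Λ (A k)).mulVec v p)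
    (hlim : ∀ p q : K d N, Tendsto (fun k => A k p q) atTop (𝓝 (Ainf p q))) (v : B4.Idx Λ N → ℝ) :
    γ * ∑ p, v p ^ 2 ≤ ∑ p, v p * (toMat Λ Ainf).mulVec v p := by
  have ht : Tendsto (fun k => ∑ p, v p * (toMat Λ (A k)).mulVec v p) atTop (𝓝 (∑ p, v p * (toMat Λ Ainf).mulVec v p)) := by
    refine tendsto_finsetSum _ fun p _ => Tendsto.const_mul _ ?_
    simp only [Matrix.mulVec, dotProduct]
    refine tendsto_finsetSum _ fun q _ => ?_
    exact (hlim _ _).mul_const _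
  exact ge_of_tendsto' ht fun k => hco k v

variable {Ω : Set (Fin d → ℤ)} {C : K d N → K d N → ℝ} {Δ : ℕ → K d N → K d N → ℝ} {Δinf : K d N → K d N → ℝ}
  {Free : K d N → Prop} [DecidablePred Free] {cC c₀ δ γ θ₀ θ : ℝ}

/-- [our object] ENTRYWISE CONVERGENCE OF THE INNER OPERATORS: `pad(CᵀΔ_kC)(p,q) → pad(CᵀΔ_∞C)(p,q)` (PART 3's `opClose_sandwich` + PART 10's
`opClose_padOp` on the rate `|Δ_∞ − Δ_k| ≤ θ₀θ^k e^{−δ·dist}`, `0 ≤ θ < 1`). -/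
theorem tendsto_padOp_sandwich (h : CovInputPad Ω C Δ Free cC c₀ δ γ θ₀ θ) (hδ : 0 < δ) (hcC : 0 ≤ cC) (hθ₀ : 0 ≤ θ₀)
    (hθ : 0 ≤ θ) (hθ1 : θ < 1) (hΔi : ∀ r s : K d N, |Δinf r s| ≤ c₀ * Real.exp (-(δ * dist r.1 s.1)))
    (hrate : ∀ k, OpClose (Set.univ : Set (Fin d → ℤ)) (Δ k) Δinf (θ₀ * θ ^ k) δ) (p q : K d N) :
    Tendsto (fun k => padOp Free (sandwich C (Δ k)) p q) atTop (𝓝 (padOp Free (sandwich C Δinf) p q)) := by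
  have hs := sandwichConst_nonneg d N cC hδ
  refine LimitRate.tendsto_of_abs_sub_le_geometric
    (c₀ := sandwichConst d N cC δ * θ₀ * Real.exp (-(δ / 2 * dist p.1 q.1))) hθ hθ1 fun k => ?_
  have hε : 0 ≤ sandwichConst d N cC δ * (θ₀ * θ ^ k) := by positivity
  have hc := opClose_padOp (Free := Free) hε (opClose_sandwich hδ hcC h.hC (h.hΔ k) hΔi (hrate k)) p q
    (Set.mem_univ _) (Set.mem_univ _)
  rw [abs_sub_comm] at hc
  calc |padOp Free (sandwich C (Δ k)) p q - padOp Free (sandwich C Δinf) p q|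
      ≤ sandwichConst d N cC δ * (θ₀ * θ ^ k) * Real.exp (-(δ / 2 * dist p.1 q.1)) := hc
    _ = sandwichConst d N cC δ * θ₀ * Real.exp (-(δ / 2 * dist p.1 q.1)) * θ ^ k := by ring

/-- [our object] **(2.157) FOR THE LIMIT OPERATOR, INHERITED**: `γ‖v‖² ≤ ⟨v, (pad(CᵀΔ_∞C))_Λ v⟩` for every finite `Λ ⊆ Ω` with the family's `γ`
(`0 ≤ θ < 1`). -/
theorem coer_padOp_sandwich_lim (h : CovInputPad Ω C Δ Free cC c₀ δ γ θ₀ θ) (hδ : 0 < δ) (hcC : 0 ≤ cC) (hθ₀ : 0 ≤ θ₀)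
    (hθ : 0 ≤ θ) (hθ1 : θ < 1) (hΔi : ∀ r s : K d N, |Δinf r s| ≤ c₀ * Real.exp (-(δ * dist r.1 s.1)))
    (hrate : ∀ k, OpClose (Set.univ : Set (Fin d → ℤ)) (Δ k) Δinf (θ₀ * θ ^ k) δ)
    (Λ : Finset (Fin d → ℤ)) (hΛ : (↑Λ : Set (Fin d → ℤ)) ⊆ Ω) (v : B4.Idx Λ N → ℝ) :
    γ * ∑ p, v p ^ 2 ≤ ∑ p, v p * (toMat Λ (padOp Free (sandwich C Δinf))).mulVec v p :=
  coer_of_tendsto (fun k w => h.hcoer k Λ hΛ w) (fun p q => tendsto_padOp_sandwich h hδ hcC hθ₀ hθ hθ1 hΔi hrate p q) v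

end Coer

/-! ## §3 The generic END: rate to, decay of, and convergence to the perfect covariance -/

section End

variable {d N : ℕ} {Ω : Set (Fin d → ℤ)} {C : K d N → K d N → ℝ} {Δ : ℕ → K d N → K d N → ℝ} {Δinf : K d N → K d N → ℝ}
  {Free : K d N → Prop} [DecidablePred Free] {cC c₀ δ γ θ₀ θ : ℝ}

/-- [our object] **RATE TO THE PERFECT COVARIANCE WITH PART 10's CONSTANTS**: under PART 10's socket for the family, the limit operator's decay ∕
symmetry and the rate `|Δ_∞ − Δ_k| ≤ θ₀θ^k e^{−δ·dist}` (`0 ≤ θ < 1`):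
`|C^{(k)}_Λ(p,q) − C^{(∞)}_Λ(p,q)| ≤ C₄·θ^k·e^{−δ₄·dist}` on every `Λ ⊆ Ω`, `(C₄, δ₄)` = the displayed constants of `convC_covPad`. -/
theorem covPad_sub_covLim_abs_le (h : CovInputPad Ω C Δ Free cC c₀ δ γ θ₀ θ) (hδ : 0 < δ) (hcC : 0 ≤ cC) (hγ : 0 < γ)
    (hθ₀ : 0 ≤ θ₀) (hθ : 0 ≤ θ) (hθ1 : θ < 1)
    (hΔi : ∀ r s : K d N, |Δinf r s| ≤ c₀ * Real.exp (-(δ * dist r.1 s.1))) (hsymm : ∀ r s : K d N, Δinf r s = Δinf s r)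
    (hrate : ∀ k, OpClose (Set.univ : Set (Fin d → ℤ)) (Δ k) Δinf (θ₀ * θ ^ k) δ)
    {Λ : Set (Fin d → ℤ)} (hΛ : Λ ⊆ Ω) (k : ℕ) (p q : K d N) :
    |covPad C Δ Free Λ k p q - covLim C Δinf Free Λ p q| ≤
      sandwichConst d N cC (deltaStar d N γ (max (sandwichConst d N cC δ * c₀) 1) (δ / 2)) *
        convConst d N γ (max (sandwichConst d N cC δ * c₀) 1) (δ / 2) (sandwichConst d N cC δ * θ₀) * θ ^ k *
        Real.exp (-(deltaStar d N γ (max (sandwichConst d N cC δ * c₀) 1) (δ / 2) / 2 * dist p.1 q.1)) := by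
  have hS := covInputPad_splice h hθ₀ hθ hΔi hsymm hrate
    (coer_padOp_sandwich_lim h hδ hcC hθ₀ hθ hθ1 hΔi hrate) k
  have hc := (convC_covPad hS hδ hcC hγ hθ₀ hθ hΛ).2 k p q
  rw [covPad_splice_of_lt (Nat.lt_succ_self k), covPad_splice_of_le le_rfl] at hc
  rw [abs_sub_comm]
  exact hc

/-- [our object] **DECAY OF THE PERFECT COVARIANCE**, same constants: `|C^{(∞)}_Λ(p,q)| ≤ C₄·e^{−δ₄·dist}`. -/
theorem covLim_abs_le (h : CovInputPad Ω C Δ Free cC c₀ δ γ θ₀ θ) (hδ : 0 < δ) (hcC : 0 ≤ cC) (hγ : 0 < γ)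
    (hθ₀ : 0 ≤ θ₀) (hθ : 0 ≤ θ) (hθ1 : θ < 1)
    (hΔi : ∀ r s : K d N, |Δinf r s| ≤ c₀ * Real.exp (-(δ * dist r.1 s.1))) (hsymm : ∀ r s : K d N, Δinf r s = Δinf s r)
    (hrate : ∀ k, OpClose (Set.univ : Set (Fin d → ℤ)) (Δ k) Δinf (θ₀ * θ ^ k) δ)
    {Λ : Set (Fin d → ℤ)} (hΛ : Λ ⊆ Ω) (p q : K d N) :
    |covLim C Δinf Free Λ p q| ≤
      sandwichConst d N cC (deltaStar d N γ (max (sandwichConst d N cC δ * c₀) 1) (δ / 2)) *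
        convConst d N γ (max (sandwichConst d N cC δ * c₀) 1) (δ / 2) (sandwichConst d N cC δ * θ₀) *
        Real.exp (-(deltaStar d N γ (max (sandwichConst d N cC δ * c₀) 1) (δ / 2) / 2 * dist p.1 q.1)) := by
  have hS := covInputPad_splice h hθ₀ hθ hΔi hsymm hrate
    (coer_padOp_sandwich_lim h hδ hcC hθ₀ hθ hθ1 hΔi hrate) 0
  have hc := (convC_covPad hS hδ hcC hγ hθ₀ hθ hΛ).1 1 p q
  rw [covPad_splice_of_lt Nat.zero_lt_one] at hc
  exact hc

/-- [our object] **`C^{(k)}_Λ → C^{(∞)}_Λ` ENTRYWISE** (`0 ≤ θ < 1`). -/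
theorem tendsto_covPad_covLim (h : CovInputPad Ω C Δ Free cC c₀ δ γ θ₀ θ) (hδ : 0 < δ) (hcC : 0 ≤ cC) (hγ : 0 < γ)
    (hθ₀ : 0 ≤ θ₀) (hθ : 0 ≤ θ) (hθ1 : θ < 1)
    (hΔi : ∀ r s : K d N, |Δinf r s| ≤ c₀ * Real.exp (-(δ * dist r.1 s.1))) (hsymm : ∀ r s : K d N, Δinf r s = Δinf s r)
    (hrate : ∀ k, OpClose (Set.univ : Set (Fin d → ℤ)) (Δ k) Δinf (θ₀ * θ ^ k) δ)
    {Λ : Set (Fin d → ℤ)} (hΛ : Λ ⊆ Ω) (p q : K d N) :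
    Tendsto (fun k => covPad C Δ Free Λ k p q) atTop (𝓝 (covLim C Δinf Free Λ p q)) :=
  LimitRate.tendsto_of_abs_sub_le_geometric
    (c₀ := sandwichConst d N cC (deltaStar d N γ (max (sandwichConst d N cC δ * c₀) 1) (δ / 2)) *
        convConst d N γ (max (sandwichConst d N cC δ * c₀) 1) (δ / 2) (sandwichConst d N cC δ * θ₀) *
        Real.exp (-(deltaStar d N γ (max (sandwichConst d N cC δ * c₀) 1) (δ / 2) / 2 * dist p.1 q.1)))
    hθ hθ1 fun k => by
      have hc := covPad_sub_covLim_abs_le h hδ hcC hγ hθ₀ hθ hθ1 hΔi hsymm hrate hΛ k p q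
      calc |covPad C Δ Free Λ k p q - covLim C Δinf Free Λ p q| ≤ _ := hc
        _ = _ := by ring

/-- [our object] PART 2's ABSTRACT LIMIT OF THE INNER FAMILY IS THE EXPLICIT ONE (`Ω = ℤ^d`, `0 ≤ θ < 1`): `opLim (k ↦ pad(CᵀΔ_kC)) = pad(CᵀΔ_∞C)`. -/
theorem opLim_padOp_sandwich_eq (h : CovInputPad (Set.univ : Set (Fin d → ℤ)) C Δ Free cC c₀ δ γ θ₀ θ) (hδ : 0 < δ)
    (hcC : 0 ≤ cC) (hθ₀ : 0 ≤ θ₀) (hθ : 0 ≤ θ) (hθ1 : θ < 1)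
    (hΔi : ∀ r s : K d N, |Δinf r s| ≤ c₀ * Real.exp (-(δ * dist r.1 s.1)))
    (hrate : ∀ k, OpClose (Set.univ : Set (Fin d → ℤ)) (Δ k) Δinf (θ₀ * θ ^ k) δ) :
    opLim (fun k => padOp Free (sandwich C (Δ k))) = padOp Free (sandwich C Δinf) := by
  funext p q
  exact (tendsto_padOp_sandwich h hδ hcC hθ₀ hθ hθ1 hΔi hrate p q).limUnder_eq

end End

/-! ## §4 Bałaban's objects on `ℤ^{d+1}`: the perfect covariance `C^{(∞)}_Λ` -/

section Balaban

variable {d : ℕ}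

/-- [our object] The rate `Δ_k → Δ_∞` of `GAN24.EffectiveLaplacianLimit` in PART 1's `OpClose` currency, every `L ≥ 1`, every `k`. -/
theorem opClose_deltaZ_deltaZLim (L : ℕ) [NeZero L] (k : ℕ) :
    OpClose (Set.univ : Set (Fin (d + 1) → ℤ)) (deltaZ L k) (deltaZLim (d := d)) (theta166Z d * (((L : ℝ) ^ 2)⁻¹) ^ k) (kappaZ d) := by
  intro p q _ _
  rw [abs_sub_comm]
  exact deltaZ_sub_deltaZLim_abs_le L k p q

/-- [our object] **BAŁABAN'S PERFECT (2.156) COVARIANCE** on `ℤ^{d+1}` at blocking factor `L`, region `Λ`: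
`C^{(∞)}_Λ = C·(pad(CᵀΔ_∞C))_Λ⁻¹·Cᵀ` with `C = elimZ L` (PART 11), free set `IsFreeZ L`, and `Δ_∞ = EffectiveLaplacianLimit.deltaZLim`. -/
def covZLim (L : ℕ) (Λ : Set (Fin (d + 1) → ℤ)) : K (d + 1) (d + 1) → K (d + 1) (d + 1) → ℝ :=
  covLim (elimZ L) (deltaZLim (d := d)) (IsFreeZ L) Λ

/-- [our object] **`C^{(k)}_Λ → C^{(∞)}_Λ` AT KING'S RATIO WITH `convC_balaban`'s CONSTANTS** (`d ≥ 1`, `L ≥ 2`, every `Λ ⊆ ℤ^{d+1}`, every `k`):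
`|covPad (elimZ L) (deltaZ L) (IsFreeZ L) Λ k (b) (b′) − covZLim L Λ b b′| ≤ C₄(d,L)·(L⁻²)^k·e^{−δ₄(d,L)·|x−y|_∞}`. -/
theorem covPad_balaban_sub_covZLim_abs_le (hd : 1 ≤ d) (L : ℕ) [NeZero L] (hL : 2 ≤ L) (Λ : Set (Fin (d + 1) → ℤ)) (k : ℕ)
    (p q : K (d + 1) (d + 1)) :
    |covPad (elimZ L) (deltaZ L) (IsFreeZ L) Λ k p q - covZLim L Λ p q| ≤
      sandwichConst (d + 1) (d + 1) (Real.exp (kappaZ d * ((L : ℝ) - 1)))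
          (deltaStar (d + 1) (d + 1) (gamma2153 (d + 1) L)
            (max (sandwichConst (d + 1) (d + 1) (Real.exp (kappaZ d * ((L : ℝ) - 1))) (kappaZ d) * c166Z d) 1) (kappaZ d / 2)) *
        convConst (d + 1) (d + 1) (gamma2153 (d + 1) L)
          (max (sandwichConst (d + 1) (d + 1) (Real.exp (kappaZ d * ((L : ℝ) - 1))) (kappaZ d) * c166Z d) 1) (kappaZ d / 2)
          (sandwichConst (d + 1) (d + 1) (Real.exp (kappaZ d * ((L : ℝ) - 1))) (kappaZ d) * theta166Z d) *
        (((L : ℝ) ^ 2)⁻¹) ^ k *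
        Real.exp (-(deltaStar (d + 1) (d + 1) (gamma2153 (d + 1) L)
          (max (sandwichConst (d + 1) (d + 1) (Real.exp (kappaZ d * ((L : ℝ) - 1))) (kappaZ d) * c166Z d) 1) (kappaZ d / 2) / 2 *
            dist p.1 q.1)) :=
  covPad_sub_covLim_abs_le (covInputPad_balaban L (coer2157Z hd L)) (kappaZ_pos d) (Real.exp_pos _).le
    (gamma2153_pos (by omega) (Nat.pos_of_ne_zero (NeZero.ne L))) (theta166Z_nonneg d) (thetaSq_nonneg L) (thetaSq_lt_one hL)
    deltaZLim_abs_le deltaZLim_symm (opClose_deltaZ_deltaZLim L) (Set.subset_univ Λ) k p q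

/-- [our object] **DECAY OF BAŁABAN'S PERFECT COVARIANCE** with `convC_balaban`'s constants (`d ≥ 1`, `L ≥ 2`). -/
theorem covZLim_abs_le (hd : 1 ≤ d) (L : ℕ) [NeZero L] (hL : 2 ≤ L) (Λ : Set (Fin (d + 1) → ℤ)) (p q : K (d + 1) (d + 1)) :
    |covZLim L Λ p q| ≤
      sandwichConst (d + 1) (d + 1) (Real.exp (kappaZ d * ((L : ℝ) - 1)))
          (deltaStar (d + 1) (d + 1) (gamma2153 (d + 1) L)
            (max (sandwichConst (d + 1) (d + 1) (Real.exp (kappaZ d * ((L : ℝ) - 1))) (kappaZ d) * c166Z d) 1) (kappaZ d / 2)) *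
        convConst (d + 1) (d + 1) (gamma2153 (d + 1) L)
          (max (sandwichConst (d + 1) (d + 1) (Real.exp (kappaZ d * ((L : ℝ) - 1))) (kappaZ d) * c166Z d) 1) (kappaZ d / 2)
          (sandwichConst (d + 1) (d + 1) (Real.exp (kappaZ d * ((L : ℝ) - 1))) (kappaZ d) * theta166Z d) *
        Real.exp (-(deltaStar (d + 1) (d + 1) (gamma2153 (d + 1) L)
          (max (sandwichConst (d + 1) (d + 1) (Real.exp (kappaZ d * ((L : ℝ) - 1))) (kappaZ d) * c166Z d) 1) (kappaZ d / 2) / 2 *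
            dist p.1 q.1)) :=
  covLim_abs_le (covInputPad_balaban L (coer2157Z hd L)) (kappaZ_pos d) (Real.exp_pos _).le
    (gamma2153_pos (by omega) (Nat.pos_of_ne_zero (NeZero.ne L))) (theta166Z_nonneg d) (thetaSq_nonneg L) (thetaSq_lt_one hL)
    deltaZLim_abs_le deltaZLim_symm (opClose_deltaZ_deltaZLim L) (Set.subset_univ Λ) p q

/-- [our object] **`C^{(k)}_Λ(b,b′) → C^{(∞)}_Λ(b,b′)`** for Bałaban's objects (`d ≥ 1`, `L ≥ 2`). -/
theorem tendsto_covPad_balaban (hd : 1 ≤ d) (L : ℕ) [NeZero L] (hL : 2 ≤ L) (Λ : Set (Fin (d + 1) → ℤ))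
    (p q : K (d + 1) (d + 1)) :
    Tendsto (fun k => covPad (elimZ L) (deltaZ L) (IsFreeZ L) Λ k p q) atTop (𝓝 (covZLim L Λ p q)) :=
  tendsto_covPad_covLim (covInputPad_balaban L (coer2157Z hd L)) (kappaZ_pos d) (Real.exp_pos _).le
    (gamma2153_pos (by omega) (Nat.pos_of_ne_zero (NeZero.ne L))) (theta166Z_nonneg d) (thetaSq_nonneg L) (thetaSq_lt_one hL)
    deltaZLim_abs_le deltaZLim_symm (opClose_deltaZ_deltaZLim L) (Set.subset_univ Λ) p q

/-- [our object] **(2.157) FOR THE PERFECT LAPLACIAN** (`d ≥ 1`, `L ≥ 2`): `γ‖v‖² ≤ ⟨v, (pad(CᵀΔ_∞C))_Λ v⟩` on every finite `Λ ⊆ ℤ^{d+1}` with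
`γ = gamma2153 (d+1) L` — PART 18's `coer2157Z` inherited by the limit. -/
theorem coer2157Z_lim (hd : 1 ≤ d) (L : ℕ) [NeZero L] (hL : 2 ≤ L) (Λ : Finset (Fin (d + 1) → ℤ))
    (v : B4.Idx Λ (d + 1) → ℝ) :
    gamma2153 (d + 1) L * ∑ p, v p ^ 2 ≤
      ∑ p, v p * (toMat Λ (padOp (IsFreeZ L) (sandwich (elimZ L) (deltaZLim (d := d))))).mulVec v p :=
  coer_padOp_sandwich_lim (covInputPad_balaban L (coer2157Z hd L)) (kappaZ_pos d) (Real.exp_pos _).le (theta166Z_nonneg d)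
    (thetaSq_nonneg L) (thetaSq_lt_one hL) deltaZLim_abs_le (opClose_deltaZ_deltaZLim L) Λ (Set.subset_univ _) v

/-- [our object] PART 2's ABSTRACT INNER LIMIT IS EXPLICIT for Bałaban's objects (`L ≥ 2`):
`opLim (k ↦ pad(CᵀΔ_kC)) = pad(CᵀΔ_∞C)` with `C = elimZ L`, `Δ_∞ = deltaZLim`. -/
theorem opLim_balaban_eq (hd : 1 ≤ d) (L : ℕ) [NeZero L] (hL : 2 ≤ L) :
    opLim (fun k => padOp (IsFreeZ L) (sandwich (elimZ L) (deltaZ (d := d) L k))) =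
      padOp (IsFreeZ L) (sandwich (elimZ L) (deltaZLim (d := d))) :=
  opLim_padOp_sandwich_eq (covInputPad_balaban L (coer2157Z hd L)) (kappaZ_pos d) (Real.exp_pos _).le (theta166Z_nonneg d)
    (thetaSq_nonneg L) (thetaSq_lt_one hL) deltaZLim_abs_le (opClose_deltaZ_deltaZLim L)

/-- [our object] THE RATE IN THE WALL's `Decays` ∕ `toMKer` CURRENCY (`d ≥ 1`, `L ≥ 2`): `Decays (toMKer C^{(k)}_Λ − toMKer C^{(∞)}_Λ) (C₄·(L⁻²)^k) (δ₄/(d+1))` —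
the hypothesis shape of `HessKerDressedLimit.limMKerOf_eq_of_decays_rate` ∕ `tendsto_of_decays_rate`. -/
theorem decays_toMKer_covPad_sub_covZLim (hd : 1 ≤ d) (L : ℕ) [NeZero L] (hL : 2 ≤ L) (Λ : Set (Fin (d + 1) → ℤ)) (k : ℕ) :
    Decays (toMKer (covPad (elimZ L) (deltaZ L) (IsFreeZ L) Λ k) - toMKer (covZLim (d := d) L Λ))
      (sandwichConst (d + 1) (d + 1) (Real.exp (kappaZ d * ((L : ℝ) - 1)))
          (deltaStar (d + 1) (d + 1) (gamma2153 (d + 1) L)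
            (max (sandwichConst (d + 1) (d + 1) (Real.exp (kappaZ d * ((L : ℝ) - 1))) (kappaZ d) * c166Z d) 1) (kappaZ d / 2)) *
        convConst (d + 1) (d + 1) (gamma2153 (d + 1) L)
          (max (sandwichConst (d + 1) (d + 1) (Real.exp (kappaZ d * ((L : ℝ) - 1))) (kappaZ d) * c166Z d) 1) (kappaZ d / 2)
          (sandwichConst (d + 1) (d + 1) (Real.exp (kappaZ d * ((L : ℝ) - 1))) (kappaZ d) * theta166Z d) *
        (((L : ℝ) ^ 2)⁻¹) ^ k)
      (deltaStar (d + 1) (d + 1) (gamma2153 (d + 1) L)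
          (max (sandwichConst (d + 1) (d + 1) (Real.exp (kappaZ d * ((L : ℝ) - 1))) (kappaZ d) * c166Z d) 1) (kappaZ d / 2) / 2 /
        ((d + 1 : ℕ) : ℝ)) := by
  rw [toMKer_sub]
  refine decays_toMKer_of_bound ?_ ?_ fun p q => ?_
  · have h0 := (abs_nonneg _).trans (covPad_balaban_sub_covZLim_abs_le hd L hL Λ k ((0 : Fin (d + 1) → ℤ), (0 : Fin (d + 1)))
      ((0 : Fin (d + 1) → ℤ), (0 : Fin (d + 1))))
    simpa using h0
  · have hc' : 0 < max (sandwichConst (d + 1) (d + 1) (Real.exp (kappaZ d * ((L : ℝ) - 1))) (kappaZ d) * c166Z d) 1 :=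
      lt_max_of_lt_right one_pos
    exact (half_pos (deltaStar_pos (d + 1) (d + 1) (gamma2153_pos (by omega) (Nat.pos_of_ne_zero (NeZero.ne L))) hc'.le
      (half_pos (kappaZ_pos d)))).le
  · exact covPad_balaban_sub_covZLim_abs_le hd L hL Λ k p q

/-- [our object] **THE WALL-CURRENCY LIMIT IS THE PERFECT COVARIANCE** (`d ≥ 1`, `L ≥ 2`): asym1's constructed entrywise limit of the covariance
constituent IS `C^{(∞)}_Λ`: `limMKerOf (k ↦ toMKer C^{(k)}_Λ) = toMKer (covZLim L Λ)`. -/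
theorem limMKerOf_covPad_balaban_eq (hd : 1 ≤ d) (L : ℕ) [NeZero L] (hL : 2 ≤ L) (Λ : Set (Fin (d + 1) → ℤ)) :
    limMKerOf (fun k => toMKer (covPad (elimZ L) (deltaZ L) (IsFreeZ L) Λ k)) = toMKer (covZLim (d := d) L Λ) :=
  limMKerOf_eq_of_decays_rate (decays_toMKer_covPad_sub_covZLim hd L hL Λ) (thetaSq_nonneg L) (thetaSq_lt_one hL)

end Balaban

end

end Summit.QuantumFields.BalabanUV.Beta.GAN24.EffectiveCovarianceLimit
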